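import Literature.Probability.RandomPlanarGeometry.SelfAvoidingWalk
import Summits.CriticalPhenomena.SAWScalingLimit.Theorems.ObservableToSLE.Negative.CompactContainer

/-!
# A compact container for the curve classes of all SAWs of `Ω_δ ⊆ δℤ²` at meshes bounded below

Support lemma for `TightnessNecessity.lean` (cdisprove cycle 2 of crux `SubseqIdentification`,
stmt-CriticalPhenomena-0783), square-lattice mirror of
`ObservableToSLE/Negative/CompactContainer.lean` (hexagonal): for meshes in a compact interval
`[lo, hi] ⊆ (0, ∞)` ALL curve classes of all nontrivial self-avoiding walks of the discrete domain
`Ω_δ` of a bounded `Ω` lie in ONE compact subset of `CurveClass ℂ`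
(`exists_isCompact_forall_curve_mem_zd`): finitely many combinatorial supports (nodup lists from a
finite set of sites), each rescaled polyline moving Lipschitz-continuously with the mesh
(`dist_mk_polyline_zd_le`, from the generic `dist_polyline_map_le`).
-/

noncomputable section

open Literature.Probability.RandomPlanarGeometry Literature.Probability.RandomPlanarGeometry.SAW
  Literature.Probability.LatticeModels Literature.Probability.Percolation Literature.Probability
  MeasureTheory Filter Topology Set
open scoped NNReal ENNReal BoundedContinuousFunction

namespace Summit.CriticalPhenomena.SAWScalingLimit.Theorems.SubseqIdentification.Negative

/-! ## Polylines of `δℤ²` and the container -/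

section Container

/-- `δ·x = δ · (1·x)`. [folklore] -/
theorem meshPoint_eq_mul_one (δ : ℝ) (x : Site 2) : meshPoint δ x = (δ : ℂ) * meshPoint 1 x := by
  simp [meshPoint]

/-- The curve of a SAW of `Ω_δ ⊆ δℤ²` is the class of the rescaled polyline through its support.
[folklore] -/
theorem curve_eq_mk_polyline_zd {Ω : Set ℂ} {δ : ℝ} {u v : Site 2} (γ : DomainSAW Ω δ u v) :
    γ.curve = CurveClass.mk ⟨polyline (γ.walk.support.map (meshPoint δ))⟩ :=
  rfl

/-- The rescaled polyline of a fixed vertex list moves Lipschitz-continuously with the mesh.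
[folklore] -/
theorem dist_mk_polyline_zd_le (δ δ' : ℝ) (l : List (Site 2)) :
    dist (CurveClass.mk ⟨polyline (l.map (meshPoint δ))⟩)
        (CurveClass.mk ⟨polyline (l.map (meshPoint δ'))⟩) ≤
      dist δ δ' * ∑ v ∈ l.toFinset, ‖meshPoint 1 v‖ := by
  rw [CurveClass.dist_mk_mk]
  refine (Curve.dist_le_dist_toContinuousMap _ _).trans ?_
  refine ObservableToSLE.Negative.dist_polyline_map_le _ _ (by positivity) l fun v hv => ?_
  rw [meshPoint_eq_mul_one δ, meshPoint_eq_mul_one δ', dist_eq_norm, ← sub_mul, norm_mul,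
    ← dist_eq_norm, Complex.dist_eq, ← Complex.ofReal_sub, Complex.norm_real, Real.norm_eq_abs,
    ← Real.dist_eq]
  refine mul_le_mul_of_nonneg_left ?_ dist_nonneg
  exact Finset.single_le_sum (f := fun v => ‖meshPoint 1 v‖) (fun _ _ => norm_nonneg _)
    (List.mem_toFinset.2 hv)

/-- Continuity of the rescaled polyline in the mesh. [folklore] -/
theorem continuous_mk_polyline_zd (l : List (Site 2)) :
    Continuous fun δ : ℝ => CurveClass.mk ⟨polyline (l.map (meshPoint δ))⟩ := by
  set M : ℝ := ∑ v ∈ l.toFinset, ‖meshPoint 1 v‖ with hM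
  have hM0 : 0 ≤ M := Finset.sum_nonneg fun _ _ => norm_nonneg _
  refine Metric.continuous_iff.2 fun δ ε hε => ⟨ε / (M + 1), by positivity, fun δ' hδ' => ?_⟩
  calc dist (CurveClass.mk ⟨polyline (l.map (meshPoint δ'))⟩)
        (CurveClass.mk ⟨polyline (l.map (meshPoint δ))⟩)
        ≤ dist δ' δ * M := dist_mk_polyline_zd_le δ' δ l
    _ ≤ ε / (M + 1) * M := mul_le_mul_of_nonneg_right hδ'.le hM0
    _ < ε := by
        rw [div_mul_eq_mul_div, div_lt_iff₀ (by positivity)]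
        nlinarith

/-- For meshes in `[lo, ∞)`, `0 < lo`, the mesh vertices of a bounded domain lie in one finite
set of sites (the sites of the ball of radius `R / lo` at mesh `1`). [folklore] -/
theorem exists_finite_superset_meshVertices {Ω : Set ℂ} (hΩ : Bornology.IsBounded Ω) {lo : ℝ}
    (hlo : 0 < lo) :
    ∃ S : Set (Site 2), S.Finite ∧ ∀ δ, lo ≤ δ → meshVertices Ω δ ⊆ S := by
  obtain ⟨R, hR⟩ := hΩ.subset_ball 0
  refine ⟨meshVertices (Metric.ball (0 : ℂ) (R / lo)) 1,
    meshVertices_finite Metric.isBounded_ball one_pos, fun δ hδ v hv => ?_⟩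
  have hδ0 : 0 < δ := hlo.trans_le hδ
  have h := hR hv
  rw [Metric.mem_ball, dist_zero_right, meshPoint_eq_mul_one, norm_mul, Complex.norm_real,
    Real.norm_eq_abs, abs_of_pos hδ0] at h
  rw [mem_meshVertices_iff, Metric.mem_ball, dist_zero_right, lt_div_iff₀ hlo]
  calc ‖meshPoint 1 v‖ * lo ≤ ‖meshPoint 1 v‖ * δ := mul_le_mul_of_nonneg_left hδ (norm_nonneg _)
    _ = δ * ‖meshPoint 1 v‖ := mul_comm _ _
    _ < R := h

/-- Every vertex of a NONTRIVIAL walk of `Ω_δ` lies in the discrete domain `meshDomain Ω δ`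
(both ends of every edge of `Ω_δ` do). [folklore] -/
theorem mem_meshDomain_of_mem_support {Ω : Set ℂ} {δ : ℝ} :
    ∀ {u v : Site 2} (p : (discreteDomainGraph Ω δ).Walk u v), p.length ≠ 0 →
      ∀ {w : Site 2}, w ∈ p.support → w ∈ meshDomain Ω δ := by
  intro u v p
  induction p with
  | nil => intro h; exact absurd rfl h
  | @cons x y z hadj p' ih =>
    intro _ w hw
    rw [SimpleGraph.Walk.support_cons, List.mem_cons] at hw
    rcases hw with rfl | hw
    · exact (discreteDomainGraph_adj_iff.1 hadj).2.1
    · by_cases hp' : p'.length = 0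
      · have hnil := SimpleGraph.Walk.eq_of_length_eq_zero hp'
        subst hnil
        have : w = y := by
          have := SimpleGraph.Walk.length_eq_zero_iff.1 hp'
          rw [SimpleGraph.Walk.nil_iff_support_eq] at this
          rw [this] at hw
          simpa using hw
        subst this
        exact (discreteDomainGraph_adj_iff.1 hadj).2.2
      · exact ih hp' hw

/-- Every vertex of a walk of `Ω_δ` between DISTINCT vertices is a mesh vertex of `Ω`. [folklore] -/
theorem mem_meshVertices_of_mem_support_zd {Ω : Set ℂ} {δ : ℝ} {u v : Site 2} (huv : u ≠ v)
    (p : (discreteDomainGraph Ω δ).Walk u v) {w : Site 2} (hw : w ∈ p.support) :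
    w ∈ meshVertices Ω δ := by
  refine meshDomain_subset_meshVertices Ω δ (mem_meshDomain_of_mem_support p ?_ hw)
  intro h0
  exact huv (SimpleGraph.Walk.eq_of_length_eq_zero h0)

/-- COMPACT CONTAINER: for meshes in a compact interval `[lo, hi] ⊆ (0, ∞)` all curve classes of
all nontrivial SAWs of `Ω_δ ⊆ δℤ²`, `Ω` bounded, lie in ONE compact subset of `CurveClass ℂ`
(finitely many combinatorial supports, each moving continuously with the mesh). [folklore] -/
theorem exists_isCompact_forall_curve_mem_zd {Ω : Set ℂ} (hΩ : Bornology.IsBounded Ω) {lo hi : ℝ}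
    (hlo : 0 < lo) :
    ∃ C : Set (CurveClass ℂ), IsCompact C ∧ ∀ δ ∈ Set.Icc lo hi, ∀ (u v : Site 2), u ≠ v →
      ∀ γ : DomainSAW Ω δ u v, γ.curve ∈ C := by
  obtain ⟨S, hS, hsub⟩ := exists_finite_superset_meshVertices hΩ hlo
  set L : Set (List (Site 2)) := {l | l.Nodup ∧ ∀ x ∈ l, x ∈ S} with hL
  have hLfin : L.Finite := Literature.Probability.Percolation.finite_setOf_nodup_subset hS
  refine ⟨⋃ l ∈ L, (fun δ : ℝ => CurveClass.mk ⟨polyline (l.map (meshPoint δ))⟩) '' Set.Icc lo hi,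
    hLfin.isCompact_biUnion fun l _ => isCompact_Icc.image (continuous_mk_polyline_zd l), ?_⟩
  intro δ hδ u v huv γ
  rw [curve_eq_mk_polyline_zd]
  refine Set.mem_biUnion (x := γ.walk.support) ⟨γ.isPath.support_nodup, fun x hx => ?_⟩
    ⟨δ, hδ, rfl⟩
  exact hsub δ hδ.1 (mem_meshVertices_of_mem_support_zd huv γ.walk hx)

end Container

end Summit.CriticalPhenomena.SAWScalingLimit.Theorems.SubseqIdentification.Negative
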